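import Summits.RiemannHypothesis.RiemannHypothesis.Theorems.RuelleBandExactFirstBandStubEvenEngine
import Summits.RiemannHypothesis.RiemannHypothesis.Theorems.RuelleBandExactFirstBandStubEvenSymTranslate
import Summits.RiemannHypothesis.RiemannHypothesis.Theorems.RuelleBandExactFirstBandStubEvenExpSum
import Summits.RiemannHypothesis.RiemannHypothesis.Theorems.RuelleBandExactFirstBandStubEvenTestExists
import Summits.RiemannHypothesis.RiemannHypothesis.Theorems.RuelleBandExactFirstBandStubEvenTransfer
import Literature.NumberTheory.LFunctions.WeilGroundEnergyParitySplit
import Literature.NumberTheory.LFunctions.WeilGroundEnergyProofs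
import Literature.NumberTheory.LFunctions.WeilOddGroundState
import Literature.NumberTheory.LFunctions.WeilCriterionConverse
import Literature.NumberTheory.LFunctions.WeilExplicitFormulaProofs
import Literature.NumberTheory.LFunctions.WeilExplicitProofs
import Literature.NumberTheory.LFunctions.GeneralizedRH
import HarnessLib

/-!
# PF persistence campaign (cell `pub-rhpf`, seat cand-7, gen 7): the FLOOR-RATE DICTIONARY for the
even-sector ground energy (leaf G1.05 "floors" / door E1), part 1 — the strip bound

Mechanism/rigidity campaign; **no RH claims**.  Everything in this file is PROVED (Mathlib + tree
theorems; no named fact).  Campaign reading: a "thermometer floor" reader of the even-sector ground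
energy `ε_ev(a) = weilEvenGroundEnergy a` of Weil's truncated quadratic form is graded EXACTLY by
its exponential rate:

* `abs_re_sub_half_le_of_even_floor` — **if `ε_ev(a) ≥ -K e^{δ a}` for all windows `a > 0`
  (some `K`, `δ ≥ 0`), then every non-trivial zero of `ζ` has `|Re ρ - 1/2| ≤ δ/2`**; eventual
  floors (`a ≥ a₀`) suffice (`…_eventually`, via `even_floor_of_eventually`: `ε_ev` is
  non-increasing), and the conclusion is the quasi-Riemann hypothesis with abscissa `1/2 + δ/2`
  (`quasiRiemannHypothesis_of_even_floor`).
* Part 2 (`PfPersistenceFloorRateDichotomy.lean`) draws the consequences: `δ = 0` (bounded below ⇒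
  RH), sub-exponential floors, exponential sinking off RH at every rate `< 2|Re ρ₀ - 1/2|`, the
  dichotomy `ε_ev ≥ 0 ∨ ε_ev → -∞`, and the parity-free energy `ε ≤ ε_ev`, where the bound `δ/2`
  SHARPENS the tree's `GroundStatesConvergeToXi.abs_re_sub_half_le_of_weilGroundEnergy_ge_neg_exp`
  (`≤ δ`) by the factor `2`.

Proof.  The tree's even-sector Weil criterion (route `RuelleBand`, line `SketchIdeator1`:
`stub_evenSymTranslate`, `stub_evenExpSum`, `stub_evenTestExists`, the one-sided Landau ENGINE
`stub_evenEngine`, `stub_evenTransfer_pairCoeff`) run with an exponential weight.  For an even real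
test `g` supported in `[-r, r]` the CENTRED symmetric translate `h(t) = (g(t - x/2) + g(t + x/2))/2`
is even, lives on the window `r + |x|/2` (`tsupport_symTranslate_subset`), has `∫|h|² ≤ ∫|g|²`
(`integral_norm_sq_symTranslate_le`) and zero-side form `Q(h) = (Re B_g(x) + Q(g))/2`; the floor at
that window and the PROVED explicit formula give the one-sided bound
`Re B_g(x) ≥ -Re Q(g) - 2K e^{δ(r + |x|/2)} ∫|g|²` (`re_expSum_ge_of_even_floor`).  Hence the real
exponential sum `e^{-δx/2} B_g(x) = Σ_ρ m(ρ) P_g(ρ) e^{(ρ - 1/2 - δ/2)x}` is bounded below on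
`x ≥ 0`; its exponents are locally finite and off the real axis (`ζ(σ) ≠ 0` on `(0,1)`), so the
engine kills the fibre over every `ρ₀` with `Re ρ₀ > 1/2 + δ/2`
(`order_mul_pairCoeff_eq_zero_of_even_floor`); `P_g(ρ₀) = ĝ(ρ₀)²` and an even real bump with
`ĝ(ρ₀) ≠ 0` finish, and `ρ ↦ 1 - ρ̄` gives the left half of the strip.  Centring is what halves
the rate: the pair at mutual distance `x` costs only the window `r + x/2`.

References: E. Bombieri, *Remarks on Weil's quadratic functional in the theory of prime numbers I*,
Rend. Lincei (9) 11 (2000) 183–233, §3 Thm. 1, §4 Thm. 5; H. Yoshida, *On Hermitian forms attached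
to zeta functions*, Adv. Stud. Pure Math. 21 (1992), Prop. 1.
-/

set_option linter.dupNamespace false

noncomputable section

open Complex MeasureTheory Filter Set
open scoped Real Topology ComplexConjugate

namespace Summit.RiemannHypothesis.RiemannHypothesis.Theorems.PfPersistenceFloorRate

open Literature.NumberTheory.LFunctions
open Summit.RiemannHypothesis.RiemannHypothesis.Theorems.RuelleBandExactFirstBand

/-! ## §1 The centred symmetric translate: window and `L²` norm -/

/-- The symmetric translate `(g(t-x) + g(t+x))/2` of a function supported in `[-r, r]` is
supported in `[-(r + |x|), r + |x|]`. [folklore] -/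
theorem tsupport_symTranslate_subset {g : ℝ → ℂ} {r : ℝ} (hsupp : tsupport g ⊆ Icc (-r) r)
    (x : ℝ) :
    tsupport (fun t : ℝ => (g (t - x) + g (t + x)) / 2) ⊆ Icc (-(r + |x|)) (r + |x|) := by
  refine closure_minimal (fun t ht ↦ ?_) isClosed_Icc
  by_contra hmem
  apply ht
  have hg0 : ∀ y : ℝ, r < |y| → g y = 0 := fun y hy ↦
    image_eq_zero_of_notMem_tsupport fun hys ↦ by
      have h := hsupp hys
      rw [mem_Icc] at h
      have : |y| ≤ r := abs_le.2 ⟨h.1, h.2⟩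
      linarith
  have ht' : r + |x| < |t| := by
    rw [mem_Icc, not_and_or, not_le, not_le] at hmem
    rcases hmem with h | h
    · rcases le_or_gt 0 t with ht0 | ht0
      · rw [abs_of_nonneg ht0]; linarith
      · rw [abs_of_neg ht0]; linarith
    · exact lt_of_lt_of_le h (le_abs_self t)
  have h1 : g (t - x) = 0 := hg0 (t - x) (by
    have := abs_sub_abs_le_abs_sub t x
    linarith)
  have h2 : g (t + x) = 0 := hg0 (t + x) (by
    have := abs_sub_abs_le_abs_sub t (-x)
    rw [abs_neg, sub_neg_eq_add] at this
    linarith)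
  simp [h1, h2]

/-- `∫ |(g(t-x) + g(t+x))/2|² ≤ ∫ |g|²` (pointwise `|(p+q)/2|² ≤ (|p|² + |q|²)/2` and translation
invariance of Lebesgue measure). [folklore] -/
theorem integral_norm_sq_symTranslate_le {g : ℝ → ℂ} (hg : IsWeilTest g) (x : ℝ) :
    ∫ t, ‖(g (t - x) + g (t + x)) / 2‖ ^ 2 ≤ ∫ t, ‖g t‖ ^ 2 := by
  have h2 : Integrable fun t : ℝ ↦ ‖g t‖ ^ 2 := hg.integrable_norm_sq
  have hm : Integrable fun t : ℝ ↦ ‖g (t - x)‖ ^ 2 := h2.comp_sub_right x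
  have hp : Integrable fun t : ℝ ↦ ‖g (t + x)‖ ^ 2 := h2.comp_add_right x
  calc ∫ t, ‖(g (t - x) + g (t + x)) / 2‖ ^ 2
      ≤ ∫ t, (‖g (t - x)‖ ^ 2 + ‖g (t + x)‖ ^ 2) / 2 := by
        refine integral_mono_of_nonneg (Eventually.of_forall fun _ ↦ by positivity)
          ((hm.add hp).div_const 2) (Eventually.of_forall fun t ↦ ?_)
        have hn : ‖(g (t - x) + g (t + x)) / 2‖ ≤ (‖g (t - x)‖ + ‖g (t + x)‖) / 2 := by
          rw [norm_div, Complex.norm_two]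
          exact div_le_div_of_nonneg_right (norm_add_le _ _) zero_le_two
        calc ‖(g (t - x) + g (t + x)) / 2‖ ^ 2 ≤ ((‖g (t - x)‖ + ‖g (t + x)‖) / 2) ^ 2 :=
              pow_le_pow_left₀ (norm_nonneg _) hn 2
          _ ≤ (‖g (t - x)‖ ^ 2 + ‖g (t + x)‖ ^ 2) / 2 := by
              nlinarith [sq_nonneg (‖g (t - x)‖ - ‖g (t + x)‖)]
    _ = ∫ t, ‖g t‖ ^ 2 := by
        rw [integral_div, integral_add hm hp,
          integral_sub_right_eq_self (fun u : ℝ ↦ ‖g u‖ ^ 2) x,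
          integral_add_right_eq_self (fun u : ℝ ↦ ‖g u‖ ^ 2) x]
        ring

/-! ## §2 Floors: eventual floors are floors on every window -/

/-- An eventual exponential floor `-K e^{δa} ≤ ε_ev(a)` (`a ≥ a₀`) gives a floor with the same rate
on every window `a > 0` (with a larger non-negative constant), because `ε_ev` is non-increasing on
`(0, ∞)` (`weilEvenGroundEnergy_antitone`). [folklore] -/
theorem even_floor_of_eventually {K δ a₀ : ℝ} (hδ : 0 ≤ δ)
    (hL : ∀ a : ℝ, a₀ ≤ a → -(K * Real.exp (δ * a)) ≤ weilEvenGroundEnergy a) :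
    ∃ K' : ℝ, 0 ≤ K' ∧ ∀ a : ℝ, 0 < a → -(K' * Real.exp (δ * a)) ≤ weilEvenGroundEnergy a := by
  set a₁ : ℝ := max a₀ 1 with ha₁def
  have hK : K ≤ max K 0 := le_max_left _ _
  have hK0 : 0 ≤ max K 0 := le_max_right _ _
  have ha₁ : 0 < a₁ := lt_of_lt_of_le one_pos (le_max_right _ _)
  have hE₁ : 1 ≤ Real.exp (δ * a₁) := Real.one_le_exp (by positivity)
  refine ⟨max K 0 * Real.exp (δ * a₁), by positivity, fun a ha ↦ ?_⟩
  have hEa : 1 ≤ Real.exp (δ * a) := Real.one_le_exp (by positivity)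
  have hEa0 : 0 ≤ Real.exp (δ * a) := (Real.exp_pos _).le
  rcases le_or_gt a₁ a with h | h
  · have h0 := hL a ((le_max_left _ _).trans h)
    have h2 : K * Real.exp (δ * a) ≤ max K 0 * Real.exp (δ * a₁) * Real.exp (δ * a) := by
      calc K * Real.exp (δ * a) ≤ max K 0 * Real.exp (δ * a) := mul_le_mul_of_nonneg_right hK hEa0
        _ = max K 0 * 1 * Real.exp (δ * a) := by ring
        _ ≤ max K 0 * Real.exp (δ * a₁) * Real.exp (δ * a) := by gcongr
    linarith
  · have hanti : weilEvenGroundEnergy a₁ ≤ weilEvenGroundEnergy a :=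
      weilEvenGroundEnergy_antitone ha h.le
    have h0 := hL a₁ (le_max_left _ _)
    have h2 : K * Real.exp (δ * a₁) ≤ max K 0 * Real.exp (δ * a₁) * Real.exp (δ * a) := by
      calc K * Real.exp (δ * a₁) ≤ max K 0 * Real.exp (δ * a₁) :=
            mul_le_mul_of_nonneg_right hK (Real.exp_pos _).le
        _ = max K 0 * Real.exp (δ * a₁) * 1 := by ring
        _ ≤ max K 0 * Real.exp (δ * a₁) * Real.exp (δ * a) := by gcongr
    linarith

/-! ## §3 The floor transported to the zero side: a one-sided bound for `B_g` -/

/-- **One-sided bound.**  If `-K e^{δa} ≤ ε_ev(a)` on `a > 0` (`K, δ ≥ 0`) and `g` is an even test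
function supported in `[-r, r]`, `r > 0`, then for every real `x`
`Re B_g(x) ≥ -Re Q(g) - 2K e^{δ(r + |x|/2)} ∫|g|²`: apply the floor at the window `r + |x|/2` to
the centred symmetric translate `h = (g(· - x/2) + g(· + x/2))/2` (even, `∫|h|² ≤ ∫|g|²`), whose
zero-side form is `(Re B_g(x) + Q(g))/2` (`stub_evenSymTranslate`) and equals `W(h ⋆ h̃)` by the
proved explicit formula. [folklore] -/
theorem re_expSum_ge_of_even_floor {K δ : ℝ} (hK : 0 ≤ K)
    (hL : ∀ a : ℝ, 0 < a → -(K * Real.exp (δ * a)) ≤ weilEvenGroundEnergy a)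
    {g : ℝ → ℂ} (hg : IsWeilTest g) (heven : ∀ t : ℝ, g (-t) = g t)
    {r : ℝ} (hr : 0 < r) (hsupp : tsupport g ⊆ Icc (-r) r) (x : ℝ) :
    -(WeilConverse.zeroForm g).re - 2 * K * Real.exp (δ * (r + |x| / 2)) * ∫ t, ‖g t‖ ^ 2 ≤
      (WeilConverse.expSum g x).re := by
  obtain ⟨hh, hhev, -, -, hQ⟩ := stub_evenSymTranslate g hg (x / 2)
  have hev' := hhev heven
  have hsupp' : tsupport (fun t : ℝ => (g (t - x / 2) + g (t + x / 2)) / 2) ⊆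
      Icc (-(r + |x| / 2)) (r + |x| / 2) := by
    have h := tsupport_symTranslate_subset hsupp (x / 2)
    rwa [abs_div, abs_two] at h
  have ha : 0 < r + |x| / 2 := by positivity
  have hQW : WeilConverse.zeroForm (fun t : ℝ => (g (t - x / 2) + g (t + x / 2)) / 2) =
      weilQuadratic (fun t : ℝ => (g (t - x / 2) + g (t + x / 2)) / 2) :=
    tendsto_nhds_unique (WeilConverse.hasWeilZeroSide_zeroForm hh)
      (explicit_formula_holds (hh.weilConv hh.weilReflect))
  have hfloor := weilEvenGroundEnergy_mul_le_re hh hsupp' hev'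
  have hN := integral_norm_sq_symTranslate_le hg (x / 2)
  have hN0 : 0 ≤ ∫ t, ‖(g (t - x / 2) + g (t + x / 2)) / 2‖ ^ 2 :=
    integral_nonneg fun _ ↦ by positivity
  have hE0 : 0 ≤ K * Real.exp (δ * (r + |x| / 2)) := by positivity
  have h1 : -(K * Real.exp (δ * (r + |x| / 2))) * ∫ t, ‖g t‖ ^ 2 ≤
      weilEvenGroundEnergy (r + |x| / 2) * ∫ t, ‖(g (t - x / 2) + g (t + x / 2)) / 2‖ ^ 2 :=
    calc -(K * Real.exp (δ * (r + |x| / 2))) * ∫ t, ‖g t‖ ^ 2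
        ≤ -(K * Real.exp (δ * (r + |x| / 2))) * ∫ t, ‖(g (t - x / 2) + g (t + x / 2)) / 2‖ ^ 2 :=
          mul_le_mul_of_nonpos_left hN (by linarith)
      _ ≤ _ := mul_le_mul_of_nonneg_right (hL _ ha) hN0
  have h2 := h1.trans hfloor
  rw [← hQW, hQ, show 2 * (x / 2) = x by ring, Complex.div_ofNat_re, Complex.add_re,
    Complex.ofReal_re] at h2
  linarith

/-! ## §4 The weighted one-sided engine: no zero-sum modes beyond the half-rate -/

/-- **No modes with `Re ρ > 1/2 + δ/2`.**  Under the even floor `-K e^{δa} ≤ ε_ev(a)` (`a > 0`,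
`K, δ ≥ 0`), for every even test function `g` and every non-trivial zero `ρ₀` with
`Re ρ₀ > 1/2 + δ/2`: `m(ρ₀) P_g(ρ₀) = 0`.  The engine `stub_evenEngine` is applied to the REAL
series `e^{-δx/2} B_g(x) = Σ_ρ m(ρ) P_g(ρ) e^{(ρ - 1/2 - δ/2)x}` (`B_g` is real for even `g`,
`stub_evenExpSum`), bounded below on `x ≥ 0` by §3; its exponents have real part `≤ 1/2`, are
locally finite (`riemannZetaNontrivialZeros_finite_inter_ball`) and have `Im = Im ρ ≠ 0`
(`riemannZetaNontrivialZeros.im_ne_zero`); the fibre over `ρ₀ - 1/2 - δ/2` is `{ρ₀}`. [folklore] -/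
theorem order_mul_pairCoeff_eq_zero_of_even_floor {K δ : ℝ} (hK : 0 ≤ K) (hδ : 0 ≤ δ)
    (hL : ∀ a : ℝ, 0 < a → -(K * Real.exp (δ * a)) ≤ weilEvenGroundEnergy a)
    {g : ℝ → ℂ} (hg : IsWeilTest g) (heven : ∀ t : ℝ, g (-t) = g t)
    {ρ₀ : ℂ} (hρ₀ : ρ₀ ∈ ZetaZeros.riemannZetaNontrivialZeros) (hre : 1 / 2 + δ / 2 < ρ₀.re) :
    (riemannZetaZeroOrder ρ₀ : ℂ) * WeilConverse.pairCoeff g ρ₀ = 0 := by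
  obtain ⟨r, hr, hsupp⟩ := hg.exists_tsupport_subset_Icc
  set Q₀ : ℝ := (WeilConverse.zeroForm g).re with hQ₀
  set N₀ : ℝ := ∫ t, ‖g t‖ ^ 2 with hN₀
  have hN₀0 : 0 ≤ N₀ := integral_nonneg fun _ ↦ by positivity
  have hBreal : ∀ y : ℝ, (WeilConverse.expSum g y).im = 0 := fun y ↦
    ((stub_evenExpSum g hg heven).2 y).2
  have hB : ∀ y : ℝ, -Q₀ - 2 * K * Real.exp (δ * (r + |y| / 2)) * N₀ ≤
      (WeilConverse.expSum g y).re :=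
    fun y ↦ re_expSum_ge_of_even_floor hK hL hg heven hr hsupp y
  -- the weighted series
  have hF : ∀ x : ℝ, ∑' ρ : ZetaZeros.riemannZetaNontrivialZeros,
      (riemannZetaZeroOrder (ρ : ℂ) : ℂ) * WeilConverse.pairCoeff g ρ *
        cexp (((ρ : ℂ) - 1 / 2 - δ / 2) * x) =
      ((Real.exp (-(δ / 2 * x)) : ℝ) : ℂ) * WeilConverse.expSum g x := by
    intro x
    rw [WeilConverse.expSum, ← tsum_mul_left]
    refine tsum_congr fun ρ ↦ ?_
    rw [Complex.ofReal_exp,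
      show (((ρ : ℂ) - 1 / 2 - δ / 2) * x : ℂ) = ((-(δ / 2 * x) : ℝ) : ℂ) + ((ρ : ℂ) - 1 / 2) * x by
        push_cast; ring,
      Complex.exp_add]
    ring
  have h := stub_evenEngine ZetaZeros.riemannZetaNontrivialZeros
    (fun ρ : ZetaZeros.riemannZetaNontrivialZeros ↦
      (riemannZetaZeroOrder (ρ : ℂ) : ℂ) * WeilConverse.pairCoeff g ρ)
    (fun ρ : ZetaZeros.riemannZetaNontrivialZeros ↦ (ρ : ℂ) - 1 / 2 - δ / 2) (1 / 2)
    (max Q₀ 0 + 2 * K * Real.exp (δ * r) * N₀) (WeilConverse.summable_norm_pairCoeff hg)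
    (fun ρ ↦ ?_) (fun z ↦ ?_) (fun ρ _ ↦ ?_) (fun x hx ↦ ?_) (fun x hx ↦ ?_) (ρ₀ - 1 / 2 - δ / 2)
    ?_ {⟨ρ₀, hρ₀⟩} (fun ρ ↦ ?_)
  · simpa using h
  · -- `Re λ ≤ 1/2`
    have h1 := (le_abs_self _).trans (WeilConverse.abs_re_sub_half_le ρ.2)
    have h2 : ((ρ : ℂ) - 1 / 2 - δ / 2).re = ((ρ : ℂ) - 1 / 2).re - δ / 2 := by
      simp [Complex.sub_re]
    rw [h2]
    linarith
  · -- local finiteness of the exponents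
    refine ⟨1, one_pos, ?_⟩
    refine ((riemannZetaNontrivialZeros_finite_inter_ball (z + 1 / 2 + δ / 2) 1).preimage
      (Subtype.val_injective.injOn)).subset fun ρ hρ ↦ ?_
    simp only [mem_setOf_eq, Metric.mem_ball, dist_eq_norm] at hρ
    refine ⟨ρ.2, ?_⟩
    rw [Metric.mem_ball, dist_eq_norm]
    rwa [show (ρ : ℂ) - (z + 1 / 2 + δ / 2) = (ρ : ℂ) - 1 / 2 - δ / 2 - z by ring]
  · -- the exponents are off the real axis
    simpa [Complex.sub_im] using ZetaZeros.riemannZetaNontrivialZeros.im_ne_zero ρ.2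
  · -- the weighted series is real
    rw [hF x, Complex.im_ofReal_mul, hBreal x, mul_zero]
  · -- and bounded below on `x ≥ 0`
    rw [hF x, Complex.re_ofReal_mul]
    have hBx := hB x
    rw [abs_of_nonneg hx] at hBx
    set e : ℝ := Real.exp (-(δ / 2 * x)) with he
    have he0 : 0 < e := Real.exp_pos _
    have he1 : e ≤ 1 := Real.exp_le_one_iff.2 (by nlinarith)
    have hee : e * Real.exp (δ * (r + x / 2)) = Real.exp (δ * r) := by
      rw [he, ← Real.exp_add]
      congr 1
      ring
    have h1 : e * (-Q₀ - 2 * K * Real.exp (δ * (r + x / 2)) * N₀) ≤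
        e * (WeilConverse.expSum g x).re :=
      mul_le_mul_of_nonneg_left hBx he0.le
    have h2 : e * Q₀ ≤ max Q₀ 0 :=
      calc e * Q₀ ≤ e * max Q₀ 0 := mul_le_mul_of_nonneg_left (le_max_left _ _) he0.le
        _ ≤ 1 * max Q₀ 0 := mul_le_mul_of_nonneg_right he1 (le_max_right _ _)
        _ = max Q₀ 0 := one_mul _
    have h3 : e * (-Q₀ - 2 * K * Real.exp (δ * (r + x / 2)) * N₀) =
        -(e * Q₀) - 2 * K * (e * Real.exp (δ * (r + x / 2))) * N₀ := by ring
    rw [h3, hee] at h1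
    linarith
  · -- `Re μ > 0`
    have h2 : (ρ₀ - 1 / 2 - (δ : ℂ) / 2).re = ρ₀.re - 1 / 2 - δ / 2 := by
      simp [Complex.sub_re]
    rw [h2]
    linarith
  · -- the fibre over `μ` is `{ρ₀}`
    rw [Finset.mem_singleton, sub_left_inj, sub_left_inj]
    constructor
    · rintro rfl; rfl
    · intro h; exact Subtype.ext h

/-! ## §5 The dictionary: floor rate `δ` ⇒ strip half-width `δ/2` -/

/-- **Right half.**  Under the even floor with rate `δ ≥ 0` every non-trivial zero has
`Re ρ ≤ 1/2 + δ/2`: an even real bump `g` with `ĝ(ρ) ≠ 0` (`stub_evenTestExists`) has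
`P_g(ρ) = ĝ(ρ)²` (`stub_evenTransfer_pairCoeff`) and `m(ρ) ≥ 1`, contradicting §4. [folklore] -/
theorem re_le_of_even_floor {K δ : ℝ} (hδ : 0 ≤ δ)
    (hL : ∀ a : ℝ, 0 < a → -(K * Real.exp (δ * a)) ≤ weilEvenGroundEnergy a)
    {ρ : ℂ} (hρ : ρ ∈ ZetaZeros.riemannZetaNontrivialZeros) : ρ.re ≤ 1 / 2 + δ / 2 := by
  have hL' : ∀ a : ℝ, 0 < a → -(max K 0 * Real.exp (δ * a)) ≤ weilEvenGroundEnergy a :=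
    fun a ha ↦ le_trans (neg_le_neg (mul_le_mul_of_nonneg_right (le_max_left _ _)
      (Real.exp_pos _).le)) (hL a ha)
  by_contra hre
  rw [not_le] at hre
  obtain ⟨g, hg, heven, hreal, hg0⟩ := stub_evenTestExists ρ
  have h := order_mul_pairCoeff_eq_zero_of_even_floor (le_max_right _ _) hδ hL' hg heven hρ hre
  have hm : (riemannZetaZeroOrder ρ : ℂ) ≠ 0 := by
    have := ZetaZeros.riemannZetaNontrivialZeros.one_le_order hρ
    exact_mod_cast (by omega : riemannZetaZeroOrder ρ ≠ 0)
  rw [stub_evenTransfer_pairCoeff heven hreal, mul_eq_zero, or_iff_right hm] at h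
  exact hg0 (mul_self_eq_zero.1 h)

/-- **THE FLOOR-RATE DICTIONARY (even sector).**  If `-K e^{δa} ≤ ε_ev(a)` for all `a > 0`
(some `K`, `δ ≥ 0`), then every non-trivial zero of `ζ` satisfies `|Re ρ - 1/2| ≤ δ/2` (right half
by `re_le_of_even_floor`, left half by the reflection `ρ ↦ 1 - ρ̄` of the zero set). [folklore] -/
theorem abs_re_sub_half_le_of_even_floor {K δ : ℝ} (hδ : 0 ≤ δ)
    (hL : ∀ a : ℝ, 0 < a → -(K * Real.exp (δ * a)) ≤ weilEvenGroundEnergy a)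
    {ρ : ℂ} (hρ : ρ ∈ ZetaZeros.riemannZetaNontrivialZeros) : |ρ.re - 1 / 2| ≤ δ / 2 := by
  have h1 := re_le_of_even_floor hδ hL hρ
  have h2 := re_le_of_even_floor hδ hL (ZetaZeros.riemannZetaNontrivialZeros.one_sub_conj_mem hρ)
  rw [WeilConverse.one_sub_conj_re] at h2
  rw [abs_le]
  constructor <;> linarith

/-- Eventual floors suffice: `-K e^{δa} ≤ ε_ev(a)` for `a ≥ a₀` ⇒ `|Re ρ - 1/2| ≤ δ/2` for every
non-trivial zero. [folklore] -/
theorem abs_re_sub_half_le_of_even_floor_eventually {K δ a₀ : ℝ} (hδ : 0 ≤ δ)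
    (hL : ∀ a : ℝ, a₀ ≤ a → -(K * Real.exp (δ * a)) ≤ weilEvenGroundEnergy a)
    {ρ : ℂ} (hρ : ρ ∈ ZetaZeros.riemannZetaNontrivialZeros) : |ρ.re - 1 / 2| ≤ δ / 2 := by
  obtain ⟨K', -, hK'⟩ := even_floor_of_eventually hδ hL
  exact abs_re_sub_half_le_of_even_floor hδ hK' hρ

/-- **Quasi-RH from an even floor**: `-K e^{δa} ≤ ε_ev(a)` for `a ≥ a₀` (`δ ≥ 0`) implies that `ζ`
has no zeros in `1/2 + δ/2 < Re s < 1` (`QuasiRiemannHypothesis (1/2 + δ/2)`). [folklore] -/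
theorem quasiRiemannHypothesis_of_even_floor {K δ a₀ : ℝ} (hδ : 0 ≤ δ)
    (hL : ∀ a : ℝ, a₀ ≤ a → -(K * Real.exp (δ * a)) ≤ weilEvenGroundEnergy a) :
    QuasiRiemannHypothesis (1 / 2 + δ / 2) := by
  intro s hs h0 h1
  have hmem : s ∈ ZetaZeros.riemannZetaNontrivialZeros :=
    ZetaZeros.riemannZetaNontrivialZeros.mem_iff'.2 ⟨hs, by linarith, h1⟩
  have h := abs_re_sub_half_le_of_even_floor_eventually hδ hL hmem
  rw [abs_le] at h
  linarith [h.2]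

end Summit.RiemannHypothesis.RiemannHypothesis.Theorems.PfPersistenceFloorRate

end
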